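import Literature.Geometry.Riemannian.CanonicalNeighbourhoods
import Literature.Geometry.Riemannian.PinchingEstimates
import Literature.Geometry.Riemannian.RicciFlowRegularity
import HarnessLib

/-!
# Chen–Zhu's canonical neighbourhood theorem (2006, Thm. 4.1) in the form used in §5, and the
# reduction of the a priori assumptions of the smooth solution to it
(topic `Geometry/Riemannian`)

First layer of the decomposition of the named fact
`Literature.Geometry.Riemannian.chenZhu_aprioriAssumptions_smoothSolution`
(`CanonicalNeighbourhoods.lean`; Chen–Zhu 2006, §5, arXiv p. 26: "It follows from Lemma 2.1 and
Theorem 4.1 that the a priori assumptions above hold for the smooth solution on `[0, T₀)`").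
That sentence quotes four inputs, three of which are already vendored —
Lemma 2.1 (`hamilton_chenZhu_pinching`, `PinchingEstimates.lean`), Perelman's no local collapsing
theorem I as used on p. 19 (`perelman_noLocalCollapsing`, `CanonicalNeighbourhoods.lean`) and the
preservation of PIC (`ricciFlow_preserves_positiveIsotropicCurvature`, `RicciFlow.lean`) — and the
fourth is **Theorem 4.1** (p. 19), the canonical neighbourhood theorem for smooth solutions,
vendored here as a named fact in exactly the form in which §5 consumes it. This file then PROVES
the quoted sentence: the a priori assumptions of the smooth maximal solution follow from these
named facts, the one silent step of the printed argument — Theorem 4.1 only speaks about times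
`t₀ ≥ 1`, and the early times are covered because the smooth solution has bounded curvature on
`M × [0, 1]` — being made explicit through a regularity fact (joint continuity of the scalar
curvature of a smooth family) and its proved corollary (boundedness on compact time intervals).

## Contents

* NAMED FACT `chenZhu_canonicalNeighbourhoodTheorem` — **Chen–Zhu 2006, Thm. 4.1** (p. 19), with
  the constants of Thm. 3.8 (p. 17) and Prop. 3.6 (p. 16), in the form used on p. 26 and p. 35
  ("In Theorem 4.1 we have obtained the canonical neighborhood structure for smooth solutions"):
  given `ε` (small), `κ, θ, ρ, Λ, P > 0` and a bound `T₁` for the final time there is `r₀ > 0`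
  such that for every Ricci flow of Riemannian PIC metrics on `[0, T)`, `1 < T ≤ T₁`, on a closed
  simply connected 4-manifold which is `κ`-noncollapsed on scales `≤ θ` and satisfies the
  pinching (2.1)–(2.3) with constants `ρ, Λ, P`, every `(x₀, t₀)` with `t₀ ≥ 1` and
  `R(x₀, t₀) ≥ r₀⁻²` has a canonical neighbourhood with accuracy `ε` and constants
  `C₁(ε), C₂(ε), η` (`HasCanonicalNeighbourhood`, C⁰ form). The dependence of `r₀` on `T₁`
  (review of 2026-08-15, see the docstring of the fact) makes explicit the bound on the factor
  `e^{Pt}` of (2.3) which the printed proof uses (Step 2, arXiv p. 22 = JDG p. 217: the limit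
  "satisfies the restricted isotropic curvature pinching condition (2.4) by the assumptions
  (2.1), (2.2) and (2.3)") and which is tacit in §4, whose solutions are maximal solutions of a
  fixed compact PIC manifold with `T < +∞` (p. 19; Hamilton 1997, §2.1, remark after Thm. 1.9,
  p. 13: "the minimum of the scalar curvature at `t = 0` determines an upper bound `T` on the
  time the solution can exist. This gives a uniform bound on the constant `e^{Pt}`").
* PROVED `chenZhu_canonicalNeighbourhoodTheorem.of_uniform` — the restated fact is implied by the
  literal printed form (one `r₀` for all final times `T > 1`), i.e. the restatement only weakens.
* NAMED FACT (regularity) `continuousOn_scalarCurvatureWith_family` — for a family of `C^∞`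
  metrics jointly smooth on `M × [0, T)` (`IsContMDiffFamilyOn`) with Levi-Civita witnesses, the
  scalar curvature `(x, t) ↦ R_{g_t}(x)` is continuous on `M × [0, T)` (O'Neill 1983, Def. 3.53:
  `S = C(Ric)` is a smooth function of the metric; Topping 2006, §1.2.3: "`g(t)` is a smooth
  family of smooth metrics – smooth all the way to `t = 0`"). The parametric sibling of
  `contMDiff_scalarCurvatureWith` (`RicciFlowScalarCurvatureProofs.lean`, discharged in
  `RicciFlowScalarCurvatureHolds.lean`).
* PROVED `exists_scalarCurvatureWith_le_of_family` — on a compact manifold the scalar curvature of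
  such a family is bounded above on `M × [0, t₁]` for every `t₁ < T` (Topping 2006, §7.3: "picking
  `(p_i, t_i)` to maximise `|Rm|` over `M × [0, T - 1/i]`"), from the regularity fact.
* PROVED `chenZhu_aprioriAssumptions_smoothSolution_of_canonicalNeighbourhoodTheorem` — **the
  sentence of §5, p. 26**: `chenZhu_canonicalNeighbourhoodTheorem`, `perelman_noLocalCollapsing`,
  `hamilton_chenZhu_pinching`, `ricciFlow_preserves_positiveIsotropicCurvature` and
  `continuousOn_scalarCurvatureWith_family` imply `chenZhu_aprioriAssumptions_smoothSolution`.
  Proof as in print: Perelman gives `κ` (all scales `< √T`, and `√T > 1 =: θ`), Lemma 2.1 gives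
  `ρ, Λ, P`, Thm. B1.2 gives PIC along the flow, Thm. 4.1 gives `r₀`; with `K` a bound for `R` on
  `M × [0, 1]` the constant `r := min (r₀, (K⁺ + 1)^{-1/2})` is positive and non-increasing, no
  point of `[0, 1)` has `R ≥ r⁻²`, and at times `t ≥ 1` the threshold `r⁻² ≥ r₀⁻²` invokes Thm. 4.1.

## What is NOT here (the remaining debt below `chenZhu_canonicalNeighbourhoodTheorem`)

Theorem 4.1 proper concludes that the parabolic region of size `ε⁻¹ R^{-1/2}` around `(x₀, t₀)`
is, after scaling, `ε`-close in the `C^{[ε⁻¹]}` topology to the corresponding subset of an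
ancient `κ`-solution with restricted isotropic curvature pinching (§3), and the canonical
neighbourhood is read off from Thm. 3.8 (structure of ancient `κ`-solutions, constants
`C₁(ε), C₂(ε)` depending only on `ε` by the universal noncollapsing Thm. 3.5) and Prop. 3.6
(universal `η`). Stating that conclusion needs ancient `κ`-solutions and parabolic
`C^{[ε⁻¹]}`-closeness of flows on regions (`CkNecks.lean` has the neck model only); proving it is
Perelman's refined rescaling argument (Thm. 12.1 of the first paper) over Hamilton's compactness
theorem, Shi's estimates, the Li–Yau–Hamilton inequality and Perelman's reduced volume. The fact
below is therefore the COMBINATION "Thm. 4.1 + Thm. 3.8 + Prop. 3.6" as the authors use it, and is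
to be split along these lines when the §3 vocabulary exists.

## References

* B.-L. Chen, X.-P. Zhu, *Ricci flow with surgery on four-manifolds with positive isotropic
  curvature*, J. Differential Geom. 74 (2006) 177–264 (arXiv:math/0504478): §3, p. 7
  (`κ`-noncollapsing), Prop. 3.6 (p. 16), Thm. 3.8 (p. 17), Thm. 4.1 (p. 19), §5, p. 26 (a priori
  assumptions; "It follows from Lemma 2.1 and Theorem 4.1 …"), p. 35. [ChenZhu2006]
* G. Perelman, *The entropy formula for the Ricci flow and its geometric applications*,
  arXiv:math/0211159 (2002), §4, Thm. 4.1; §12, Thm. 12.1. [Perelman2002]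
* R. S. Hamilton, *Four-manifolds with positive isotropic curvature*, Comm. Anal. Geom. 5 (1997),
  Thms. B1.1, B1.2, B2.3. [Hamilton1997]
* P. Topping, *Lectures on the Ricci flow*, LMS Lecture Note Series 325 (2006), §1.2.3 (smooth
  families), §7.3 (maximising `|Rm|` over `M × [0, T - 1/i]`). [Topping2006]
* B. O'Neill, *Semi-Riemannian geometry* (1983), Ch. 3, Def. 3.53. [ONeill1983]
-/

noncomputable section

open Bundle Set Metric Function
open scoped Manifold ContDiff Topology ENNReal

namespace Literature.Geometry.Riemannian

open Lorentzian Lorentzian.PseudoRiemannianMetric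

universe u v w

/-! ### Regularity: the scalar curvature of a smooth family is jointly continuous -/

/-- NAMED FACT (regularity of the scalar curvature of a smooth family; **O'Neill 1983, Ch. 3,
Def. 3.53**: "the scalar curvature `S` of `M` is the contraction `C(Ric) ∈ 𝔉(M)`" — a smooth
function, computed in a chart from the metric coefficients and their derivatives up to order two;
**Topping 2006, §1.2.3**: "`g(t)` is a smooth family of smooth metrics – smooth all the way to
`t = 0` and `t = T`", under which convention all curvature quantities are smooth on
`M × [0, T]`). **Vended form**, in the encoding of this layer: for a one-parameter family `g` of
`C^∞` pseudo-Riemannian metrics on a `C^∞` manifold without boundary (finite-dimensional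
complete model space) which is jointly `C^∞` on `M × [0, T)` (`IsContMDiffFamilyOn ∞ g (Ico 0 T)`,
one-sided at `t = 0`), and any Levi-Civita witnesses `cov t` of `g t` (`IsLeviCivita`; by the
fundamental lemma, `IsLeviCivita.eq_leviCivita_holds`, the curvature of `cov t` is that of `g t`),
the scalar curvature `(x, t) ↦ scalarCurvatureWith (g t) (cov t) x` is continuous on
`M × [0, T)`. The parametric sibling of `contMDiff_scalarCurvatureWith` (smoothness in `x` for one
metric, proved in `RicciFlowScalarCurvatureHolds.lean`); only continuity is vended, which is
what the compactness arguments of the layer use. Users take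
`(h : continuousOn_scalarCurvatureWith_family)`.
[cite: ONeill1983, Ch. 3, Def. 3.53] [cite: Topping2006, §1.2.3] -/
def continuousOn_scalarCurvatureWith_family : Prop :=
  ∀ {E : Type u} [NormedAddCommGroup E] [NormedSpace ℝ E] [FiniteDimensional ℝ E]
    [CompleteSpace E] {H : Type v} [TopologicalSpace H] (I : ModelWithCorners ℝ E H)
    [I.Boundaryless] (M : Type w) [TopologicalSpace M] [ChartedSpace H M] [IsManifold I ∞ M]
    (T : ℝ) (g : ℝ → PseudoRiemannianMetric I ∞ E (TangentSpace I : M → Type _))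
    (cov : ℝ → CovariantDerivative I E (TangentSpace I : M → Type _)),
    IsContMDiffFamilyOn ∞ g (Ico 0 T) → (∀ t ∈ Ico 0 T, (g t).IsLeviCivita (cov t)) →
      ContinuousOn (fun p : M × ℝ ↦ (g p.2).scalarCurvatureWith (cov p.2) p.1) (univ ×ˢ Ico 0 T)

/-- **Bounded curvature before the singular time** (Topping 2006, §7.3: for a Ricci flow on a
closed manifold on `[0, T)` one picks "`(p_i, t_i)` to maximise `|Rm|` over `M × [0, T - 1/i]`" —
the curvature of the smooth solution is bounded on every `M × [0, t₁]`, `t₁ < T`; Chen–Zhu 2006,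
§5, p. 26 likewise speak of "the set of all points where the curvature stays bounded as `t → T`").
PROVED here for the scalar curvature, from the regularity fact
`continuousOn_scalarCurvatureWith_family`: on a compact manifold, for a family jointly smooth on
`M × [0, T)` with Levi-Civita witnesses and every `t₁ < T`, there is `K` with `R(x, t) ≤ K` for
all `x` and all `t ∈ [0, t₁]` (a continuous function is bounded above on the compact set
`M × [0, t₁]`). [cite: Topping2006, §7.3] -/
theorem exists_scalarCurvatureWith_le_of_family (hreg : continuousOn_scalarCurvatureWith_family.{u, v, w})
    {E : Type u} [NormedAddCommGroup E] [NormedSpace ℝ E] [FiniteDimensional ℝ E]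
    [CompleteSpace E] {H : Type v} [TopologicalSpace H] (I : ModelWithCorners ℝ E H)
    [I.Boundaryless] (M : Type w) [TopologicalSpace M] [CompactSpace M] [ChartedSpace H M]
    [IsManifold I ∞ M] {T t₁ : ℝ} (ht₁ : t₁ < T)
    (g : ℝ → PseudoRiemannianMetric I ∞ E (TangentSpace I : M → Type _))
    (cov : ℝ → CovariantDerivative I E (TangentSpace I : M → Type _))
    (hg : IsContMDiffFamilyOn ∞ g (Ico 0 T)) (hLC : ∀ t ∈ Ico 0 T, (g t).IsLeviCivita (cov t)) :
    ∃ K : ℝ, ∀ t ∈ Icc 0 t₁, ∀ x : M, (g t).scalarCurvatureWith (cov t) x ≤ K := by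
  have hcont := hreg I M T g cov hg hLC
  have hcpt : IsCompact (univ ×ˢ Icc 0 t₁ : Set (M × ℝ)) := isCompact_univ.prod isCompact_Icc
  have hsub : (univ ×ˢ Icc 0 t₁ : Set (M × ℝ)) ⊆ univ ×ˢ Ico 0 T :=
    prod_mono le_rfl (Icc_subset_Ico_right ht₁)
  obtain ⟨K, hK⟩ := (hcpt.image_of_continuousOn (hcont.mono hsub)).bddAbove
  exact ⟨K, fun t ht x ↦ hK ⟨(x, t), ⟨mem_univ _, ht⟩, rfl⟩⟩

/-! ### Theorem 4.1 in the form used in §5 (named fact) -/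

/-- NAMED FACT (**Chen–Zhu 2006, Theorem 4.1**, arXiv p. 19: "Given `ε > 0`, `κ > 0`,
`0 < θ, ρ, Λ, P < +∞`, one can find `r₀ > 0` with the following property. If `g_ij(x,t)`,
`t ∈ [0, T)` with `T > 1`, is a solution to the Ricci flow on a four-dimensional manifold `M⁴` with
no essential incompressible space form, which has positive isotropic curvature, is
`κ`-noncollapsed on the scales `≤ θ` and satisfies (2.1), (2.2) and (2.3) in Lemma 2.1, then for
any point `(x₀, t₀)` with `t₀ ≥ 1` and `Q = R(x₀, t₀) ≥ r₀⁻²`, the solution in the parabolic region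
`{(x, t) | d²_{t₀}(x, x₀) < ε⁻² Q⁻¹, t₀ - ε⁻² Q⁻¹ < t ≤ t₀}` is, after scaling by the factor `Q`,
`ε`-close (in `C^{[ε⁻¹]}`-topology) to the corresponding subset of some ancient `κ`-solution with
restricted isotropic curvature pinching. Consequently each point `(x₀, t₀)`, with `t₀ ≥ 1` and
`Q = R(x₀, t₀) ≥ r₀⁻²`, satisfies the gradient estimates `|∇R(x₀,t₀)| < 2η R^{3/2}(x₀,t₀)` and
`|∂R/∂t (x₀,t₀)| < 2η R²(x₀,t₀)` (4.1), and has a canonical neighborhood `B` with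
`B_{t₀}(x₀, r) ⊂ B ⊂ B_{t₀}(x₀, 2r)` for some `0 < r < C₁(ε) R(x₀,t₀)^{-1/2}`, which is either an
evolving `ε`-neck, or an evolving `ε`-cap, or a compact four-manifold with positive curvature
operator. Here `η` is the universal constant in Proposition 3.6 and `C₁(ε)` is the positive
constant in Theorem 3.8"). **Vended form — Theorem 4.1 as §5 uses it** (p. 26: "It follows from
Lemma 2.1 and Theorem 4.1 that the a priori assumptions above hold for the smooth solution";
p. 35: "In Theorem 4.1 we have obtained the canonical neighborhood structure for smooth
solutions"; p. 26: "we may always assume the above `C₁` and `C₂` are twice bigger than the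
corresponding constants `C₁(ε/2)` and `C₂(ε/2)` in Theorem 3.8"), i.e. with the canonical
neighbourhood stated in the vocabulary of the canonical neighbourhood assumption of §5
(`HasCanonicalNeighbourhood`: (a) strong `ε`-neck / (b) `ε`-cap / (c) compact with positive
curvature operator, `B_t(x,σ) ⊆ B ⊆ B_t(x,2σ)`, `0 < σ < C₁ R^{-1/2}`, scalar curvature on `B`
between `C₂⁻¹R(x,t)` and `C₂R(x,t)` and the volume bound `(C₂R)⁻² ≤ Vol_t(B)` in cases (a), (b) —
the constants `C₂(ε)` of Thm. 3.8, p. 17 — and the gradient estimates `|∇R| < ηR^{3/2}`,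
`|∂R/∂t| < ηR²` on `B` with a universal `η` — Prop. 3.6, p. 16), which is WEAKER than print in the
`C⁰` neck closeness only (see `Necks.lean`). Quantifiers as printed: `η > 0` universal; the
accuracy ranges over `0 < ε ≤ ε₀` for some `ε₀ > 0` ("a fixed small positive number", p. 26; JDG
p. 220: "for any sufficiently small `ε > 0`, we can find `r₀ > 0` with the property described in
Theorem 4.1"; binding the unprinted threshold existentially only weakens the fact); `C₁, C₂ > 0`
depend on `ε` only; `r₀ > 0` depends on `ε, κ, θ, ρ, Λ, P` (uniform in the manifold and the
solution) **and — the one completion of the printed hypotheses made here (review 2026-08-15) — on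
an upper bound `T₁` for the final time `T` of the solution** (`1 < T ≤ T₁`). Reason, from the
printed proof: the improving pinching (2.3) carries the growing factor `Λ e^{Pt}` (Hamilton 1997,
§2.1, Thm. 1.9: "`b₃ ≤ H e^{Pt} √((a₁+ρ)(c₁+ρ))` is preserved … with `P = 4Ωρ`", and Thm. 2.3), and
Step 2 of the proof of Thm. 4.1 (arXiv p. 22, JDG p. 217) obtains that the blow-up limit along
the contradicting sequence `(x_k, t_k)`, `t_k ≥ 1`, "satisfies the restricted isotropic curvature
pinching condition (2.4) by the assumptions (2.1), (2.2) and (2.3)", which requires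
`Λ e^{P t_k} / log Q_k → 0`, i.e. a bound on the times `t_k < T_k`; that bound is tacit in the
setting of §4 (p. 19: maximal solutions of a fixed compact PIC manifold, "the maximal time `T` must
be finite"), exactly as in Hamilton 1997, §2.1, remark after Thm. 1.9 (p. 13): "the minimum of the
scalar curvature at `t = 0` determines an upper bound `T` on the time the solution can exist. This
gives a uniform bound on the constant `e^{Pt}`." With `T ≤ T₁` explicit the fact is the statement
the printed proof establishes; it is implied by the literal printed form
(`chenZhu_canonicalNeighbourhoodTheorem.of_uniform` below) and it is all that the printed uses
consume (JDG pp. 219–220 and §5, p. 26: one maximal solution, `T = T₀ < +∞` fixed).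
Hypotheses, in the encoding of the layer and in the setting of §4 (p. 19, compact `M⁴`):
`M : Type u` a closed (compact, Hausdorff, second countable, `C^∞`) **simply connected**
4-manifold (the case in which "no essential incompressible space form" is vacuous), with any
Borel structure for the volumes; `(g, cov)` a Ricci flow of Riemannian metrics on `[0, T)`
(`IsRicciFlow`, Levi-Civita witnesses), `1 < T ≤ T₁`; every `g t` of positive isotropic curvature;
`κ`-noncollapsed for every scale `0 < r ≤ θ` in Chen–Zhu's parabolic sense (§3, p. 7,
`IsKappaNoncollapsed`, frame-wise curvature bound); (2.1)–(2.3) with constants `ρ, Λ, P` in every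
orthonormal frame at all points and times (`Matrix.PinchedBy`, `Matrix.ImprovedPinchingAt`, as in
`hamilton_chenZhu_pinching`). Conclusion: every `(x, t)`, `t ∈ [1, T)`, with `R(x, t) ≥ r₀⁻²` has
`HasCanonicalNeighbourhood g cov (Ico 0 T) x t ε C₁ C₂ η`. Users take
`(h : chenZhu_canonicalNeighbourhoodTheorem)`.
[cite: ChenZhu2006, Thm. 4.1 (p. 19; proof, Step 2, p. 22), with Thm. 3.8 (p. 17) and Prop. 3.6 (p. 16); §5, p. 26]
[cite: Hamilton1997, §2.1, Thm. 1.9 and the remark following it (p. 13); §2.2, Thm. 2.3 (p. 17)] -/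
def chenZhu_canonicalNeighbourhoodTheorem : Prop :=
  ∃ η : ℝ, 0 < η ∧ ∃ ε₀ : ℝ, 0 < ε₀ ∧ ∀ ε : ℝ, 0 < ε → ε ≤ ε₀ → ∃ C₁ C₂ : ℝ, 0 < C₁ ∧ 0 < C₂ ∧
    ∀ κ θ ρ Λ P T₁ : ℝ, 0 < κ → 0 < θ → 0 < ρ → 0 < Λ → 0 < P → ∃ r₀ : ℝ, 0 < r₀ ∧
      ∀ (M : Type u) [TopologicalSpace M] [T2Space M] [SecondCountableTopology M] [CompactSpace M]
        [ChartedSpace (EuclideanSpace ℝ (Fin 4)) M] [IsManifold (𝓡 4) ∞ M] [SimplyConnectedSpace M]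
        [MeasurableSpace M] [BorelSpace M]
        (g : ℝ → PseudoRiemannianMetric (𝓡 4) ∞ (EuclideanSpace ℝ (Fin 4))
          (TangentSpace (𝓡 4) : M → Type _))
        (cov : ℝ → CovariantDerivative (𝓡 4) (EuclideanSpace ℝ (Fin 4))
          (TangentSpace (𝓡 4) : M → Type _)) (T : ℝ),
        IsRicciFlow g cov (Ico 0 T) → (∀ t ∈ Ico 0 T, (g t).IsRiemannian) → 1 < T → T ≤ T₁ →
        (∀ t ∈ Ico 0 T, (g t).HasPositiveIsotropicCurvature) →
        (∀ r : ℝ, 0 < r → r ≤ θ → IsKappaNoncollapsed g cov (Ico 0 T) κ r) →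
        (∀ t ∈ Ico 0 T, ∀ (x : M) (e : Fin 4 → TangentSpace (𝓡 4) x),
          (g t).IsOrthonormalFrame x e →
            Matrix.PinchedBy ((g t).blockA (cov t) x e) ((g t).blockB (cov t) x e)
                ((g t).blockC (cov t) x e) ρ Λ ∧
              Matrix.ImprovedPinchingAt ((g t).blockA (cov t) x e) ((g t).blockB (cov t) x e)
                ((g t).blockC (cov t) x e) ρ Λ P t) →
        ∀ t ∈ Ico 0 T, 1 ≤ t → ∀ x : M,
          r₀⁻¹ ^ 2 ≤ (g t).scalarCurvatureWith (cov t) x →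
            HasCanonicalNeighbourhood g cov (Ico 0 T) x t ε C₁ C₂ η

/-- **The restatement only weakens**: the literal printed form of Theorem 4.1 — one `r₀`,
depending on `ε, κ, θ, ρ, Λ, P` only, serving every final time `T > 1` (the form vended here
before the review of 2026-08-15) — implies `chenZhu_canonicalNeighbourhoodTheorem` (ignore the
bound `T ≤ T₁`). [cite: ChenZhu2006, Thm. 4.1 (p. 19)] -/
theorem chenZhu_canonicalNeighbourhoodTheorem.of_uniform
    (h : ∃ η : ℝ, 0 < η ∧ ∃ ε₀ : ℝ, 0 < ε₀ ∧ ∀ ε : ℝ, 0 < ε → ε ≤ ε₀ → ∃ C₁ C₂ : ℝ, 0 < C₁ ∧ 0 < C₂ ∧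
      ∀ κ θ ρ Λ P : ℝ, 0 < κ → 0 < θ → 0 < ρ → 0 < Λ → 0 < P → ∃ r₀ : ℝ, 0 < r₀ ∧
        ∀ (M : Type u) [TopologicalSpace M] [T2Space M] [SecondCountableTopology M] [CompactSpace M]
          [ChartedSpace (EuclideanSpace ℝ (Fin 4)) M] [IsManifold (𝓡 4) ∞ M] [SimplyConnectedSpace M]
          [MeasurableSpace M] [BorelSpace M]
          (g : ℝ → PseudoRiemannianMetric (𝓡 4) ∞ (EuclideanSpace ℝ (Fin 4))
            (TangentSpace (𝓡 4) : M → Type _))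
          (cov : ℝ → CovariantDerivative (𝓡 4) (EuclideanSpace ℝ (Fin 4))
            (TangentSpace (𝓡 4) : M → Type _)) (T : ℝ),
          IsRicciFlow g cov (Ico 0 T) → (∀ t ∈ Ico 0 T, (g t).IsRiemannian) → 1 < T →
          (∀ t ∈ Ico 0 T, (g t).HasPositiveIsotropicCurvature) →
          (∀ r : ℝ, 0 < r → r ≤ θ → IsKappaNoncollapsed g cov (Ico 0 T) κ r) →
          (∀ t ∈ Ico 0 T, ∀ (x : M) (e : Fin 4 → TangentSpace (𝓡 4) x),
            (g t).IsOrthonormalFrame x e →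
              Matrix.PinchedBy ((g t).blockA (cov t) x e) ((g t).blockB (cov t) x e)
                  ((g t).blockC (cov t) x e) ρ Λ ∧
                Matrix.ImprovedPinchingAt ((g t).blockA (cov t) x e) ((g t).blockB (cov t) x e)
                  ((g t).blockC (cov t) x e) ρ Λ P t) →
          ∀ t ∈ Ico 0 T, 1 ≤ t → ∀ x : M,
            r₀⁻¹ ^ 2 ≤ (g t).scalarCurvatureWith (cov t) x →
              HasCanonicalNeighbourhood g cov (Ico 0 T) x t ε C₁ C₂ η) :
    chenZhu_canonicalNeighbourhoodTheorem.{u} := by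
  obtain ⟨η, hη, ε₀, hε₀, H⟩ := h
  refine ⟨η, hη, ε₀, hε₀, fun ε hε hεε₀ ↦ ?_⟩
  obtain ⟨C₁, C₂, hC₁, hC₂, H⟩ := H ε hε hεε₀
  refine ⟨C₁, C₂, hC₁, hC₂, fun κ θ ρ Λ P _T₁ hκ hθ hρ hΛ hP ↦ ?_⟩
  obtain ⟨r₀, hr₀, H⟩ := H κ θ ρ Λ P hκ hθ hρ hΛ hP
  refine ⟨r₀, hr₀, ?_⟩
  intro M _ _ _ _ _ _ _ _ _ g cov T hflow hRiem hT _hT₁ hpic hnc hpinch t ht ht1 x hR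
  exact H M g cov T hflow hRiem hT hpic hnc hpinch t ht ht1 x hR

/-! ### The a priori assumptions of the smooth solution, from Theorem 4.1 (Chen–Zhu 2006, p. 26) -/

/-- **"It follows from Lemma 2.1 and Theorem 4.1 that the a priori assumptions above hold for the
smooth solution on `[0, T₀)`"** (Chen–Zhu 2006, §5, arXiv p. 26) — PROVED as a reduction of the
named fact `chenZhu_aprioriAssumptions_smoothSolution` (`CanonicalNeighbourhoods.lean`) to the
named facts it quotes: Theorem 4.1 in the form used in §5 (`chenZhu_canonicalNeighbourhoodTheorem`),
Perelman's no local collapsing theorem I as used on p. 19 (`perelman_noLocalCollapsing`),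
Lemma 2.1 (`hamilton_chenZhu_pinching`), the preservation of PIC (Hamilton 1997, Thm. B1.2,
`ricciFlow_preserves_positiveIsotropicCurvature`, which makes "has positive isotropic curvature"
available along the flow) and the regularity fact `continuousOn_scalarCurvatureWith_family`
(bounded curvature of the smooth solution on `M × [0, 1]`, the silent step covering the times
`t < 1` about which Theorem 4.1 says nothing). Given the maximal flow with `T > 1` and PIC initial
metric: Perelman gives `κ > 0` with noncollapsing on all scales `< √T`, hence on scales
`≤ θ := 1`; Lemma 2.1 gives `ρ, Λ, P`; Theorem 4.1 gives `r₀`; with `K` an upper bound of `R` on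
`M × [0, 1]`, the constant function `r := min (r₀, (max K 0 + 1)^{-1/2})` is positive and
non-increasing, no `(x, t)` with `t < 1` has `R(x,t) ≥ r⁻² > K`, and for `t ≥ 1` the threshold
`r⁻² ≥ r₀⁻²` invokes Theorem 4.1. [cite: ChenZhu2006, §5, p. 26] -/
theorem chenZhu_aprioriAssumptions_smoothSolution_of_canonicalNeighbourhoodTheorem
    (h41 : chenZhu_canonicalNeighbourhoodTheorem.{0})
    (hP : perelman_noLocalCollapsing.{0, 0, 0})
    (hL : hamilton_chenZhu_pinching.{0})
    (hPIC : ricciFlow_preserves_positiveIsotropicCurvature.{0})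
    (hreg : continuousOn_scalarCurvatureWith_family.{0, 0, 0}) :
    chenZhu_aprioriAssumptions_smoothSolution := by
  obtain ⟨η, hη, ε₀, hε₀, H⟩ := h41
  refine ⟨η, hη, ε₀, hε₀, fun ε hε hεε₀ ↦ ?_⟩
  obtain ⟨C₁, C₂, hC₁, hC₂, H⟩ := H ε hε hεε₀
  refine ⟨C₁, C₂, hC₁, hC₂, ?_⟩
  intro M _ _ _ _ _ _ _ _ _ g cov T hmax hT hpic
  -- Perelman: `κ`-noncollapsing on all scales `< √T`, in particular on scales `≤ 1 < √T`
  obtain ⟨κ, hκ, hnc⟩ := hP (𝓡 4) M T hmax.pos g cov hmax.isRicciFlow hmax.isRiemannian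
  have hsqrt : (1 : ℝ) < Real.sqrt T := (Real.lt_sqrt zero_le_one).2 (by simpa using hT)
  have hnc' : ∀ r : ℝ, 0 < r → r ≤ 1 → IsKappaNoncollapsed g cov (Ico 0 T) κ r :=
    fun r hr hr1 ↦ hnc r hr (hr1.trans_lt hsqrt)
  -- Lemma 2.1: pinching with constants depending on the initial metric
  obtain ⟨ρ, Λ, P, hρ, hΛ, hP', hpinch⟩ := hL M (g 0) (hmax.isRiemannian 0 hmax.zero_mem) hpic
  have hpinch' := hpinch T g cov hmax.isRicciFlow hmax.isRiemannian rfl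
  -- Theorem B1.2: positive isotropic curvature along the flow
  have hPIC' := hPIC M T g cov hmax.isRicciFlow hmax.isRiemannian hpic
  -- Theorem 4.1 with `θ = 1` and the final-time bound `T₁ = T`
  obtain ⟨r₀, hr₀, H41⟩ := H κ 1 ρ Λ P T hκ one_pos hρ hΛ hP'
  -- bounded scalar curvature on `M × [0, 1]`
  obtain ⟨K, hK⟩ := exists_scalarCurvatureWith_le_of_family hreg (𝓡 4) M hT g cov
    hmax.isRicciFlow.smooth hmax.isRicciFlow.isLeviCivita
  -- the (constant) threshold function
  set r₁ : ℝ := min r₀ (Real.sqrt (max K 0 + 1))⁻¹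
  have hsqrtK : 0 < Real.sqrt (max K 0 + 1) := Real.sqrt_pos.2 (by positivity)
  have hr₁ : 0 < r₁ := lt_min hr₀ (inv_pos.2 hsqrtK)
  refine ⟨fun _ ↦ r₁, fun _ _ ↦ hr₁, fun _ _ _ _ _ ↦ le_rfl, ?_⟩
  intro t ht x hR
  have hR' : r₁⁻¹ ^ 2 ≤ (g t).scalarCurvatureWith (cov t) x := hR
  by_cases ht1 : 1 ≤ t
  · -- late times: Theorem 4.1 applies since `r₁ ≤ r₀`
    refine H41 M g cov T hmax.isRicciFlow hmax.isRiemannian hT le_rfl hPIC' hnc' hpinch' t ht ht1 x ?_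
    calc r₀⁻¹ ^ 2 ≤ r₁⁻¹ ^ 2 := by
          gcongr
          exact min_le_left _ _
      _ ≤ (g t).scalarCurvatureWith (cov t) x := hR'
  · -- early times: `R ≤ K < r₁⁻²`, so the hypothesis is void
    exfalso
    have htI : t ∈ Icc (0 : ℝ) 1 := ⟨ht.1, (not_le.1 ht1).le⟩
    have h1 : (g t).scalarCurvatureWith (cov t) x ≤ K := hK t htI x
    have h2 : Real.sqrt (max K 0 + 1) ≤ r₁⁻¹ := by
      rw [le_inv_comm₀ hsqrtK hr₁]
      exact min_le_right _ _
    have h3 : max K 0 + 1 ≤ r₁⁻¹ ^ 2 := by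
      calc max K 0 + 1 = Real.sqrt (max K 0 + 1) ^ 2 := (Real.sq_sqrt (by positivity)).symm
        _ ≤ r₁⁻¹ ^ 2 := by gcongr
    have h4 : K ≤ max K 0 := le_max_left _ _
    linarith


/-! ### Appended 2026-08-15: the regularity hypothesis is now a theorem for Ricci flows

`RicciFlowRegularity.lean` proves that the scalar curvature of ANY Ricci flow is jointly
continuous on `M × S` (`IsRicciFlow.continuousOn_scalarCurvatureWith`: the flow equation
identifies `Ric` with `-½ ∂g/∂t`, whose frame components are continuous), hence bounded on
`M × [0, t₁]`, `t₁ < T`, on a compact manifold (`IsRicciFlow.exists_scalarCurvatureWith_le_of_lt`).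
So the sentence of §5, p. 26 needs only the four deep inputs. -/

/-- **"It follows from Lemma 2.1 and Theorem 4.1 that the a priori assumptions above hold for the
smooth solution on `[0, T₀)`"** (Chen–Zhu 2006, §5, arXiv p. 26), reduced hypotheses: as
`chenZhu_aprioriAssumptions_smoothSolution_of_canonicalNeighbourhoodTheorem`, with the bounded
curvature of the smooth solution on `M × [0, 1]` now PROVED for Ricci flows
(`IsRicciFlow.exists_scalarCurvatureWith_le_of_lt`, `RicciFlowRegularity.lean`) instead of taken
from the regularity fact `continuousOn_scalarCurvatureWith_family`. The named fact
`chenZhu_aprioriAssumptions_smoothSolution` thus follows from Theorem 4.1 (§5 form), Perelman's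
no local collapsing theorem I, Lemma 2.1 and the preservation of PIC alone.
[cite: ChenZhu2006, §5, p. 26] -/
theorem chenZhu_aprioriAssumptions_smoothSolution_of_canonicalNeighbourhoodTheorem'
    (h41 : chenZhu_canonicalNeighbourhoodTheorem.{0})
    (hP : perelman_noLocalCollapsing.{0, 0, 0})
    (hL : hamilton_chenZhu_pinching.{0})
    (hPIC : ricciFlow_preserves_positiveIsotropicCurvature.{0}) :
    chenZhu_aprioriAssumptions_smoothSolution := by
  obtain ⟨η, hη, ε₀, hε₀, H⟩ := h41
  refine ⟨η, hη, ε₀, hε₀, fun ε hε hεε₀ ↦ ?_⟩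
  obtain ⟨C₁, C₂, hC₁, hC₂, H⟩ := H ε hε hεε₀
  refine ⟨C₁, C₂, hC₁, hC₂, ?_⟩
  intro M _ _ _ _ _ _ _ _ _ g cov T hmax hT hpic
  -- Perelman: `κ`-noncollapsing on all scales `< √T`, in particular on scales `≤ 1 < √T`
  obtain ⟨κ, hκ, hnc⟩ := hP (𝓡 4) M T hmax.pos g cov hmax.isRicciFlow hmax.isRiemannian
  have hsqrt : (1 : ℝ) < Real.sqrt T := (Real.lt_sqrt zero_le_one).2 (by simpa using hT)
  have hnc' : ∀ r : ℝ, 0 < r → r ≤ 1 → IsKappaNoncollapsed g cov (Ico 0 T) κ r :=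
    fun r hr hr1 ↦ hnc r hr (hr1.trans_lt hsqrt)
  -- Lemma 2.1: pinching with constants depending on the initial metric
  obtain ⟨ρ, Λ, P, hρ, hΛ, hP', hpinch⟩ := hL M (g 0) (hmax.isRiemannian 0 hmax.zero_mem) hpic
  have hpinch' := hpinch T g cov hmax.isRicciFlow hmax.isRiemannian rfl
  -- Theorem B1.2: positive isotropic curvature along the flow
  have hPIC' := hPIC M T g cov hmax.isRicciFlow hmax.isRiemannian hpic
  -- Theorem 4.1 with `θ = 1` and the final-time bound `T₁ = T`
  obtain ⟨r₀, hr₀, H41⟩ := H κ 1 ρ Λ P T hκ one_pos hρ hΛ hP'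
  -- bounded scalar curvature on `M × [0, 1]`, now a theorem
  obtain ⟨K, hK⟩ := hmax.isRicciFlow.exists_scalarCurvatureWith_le_of_lt hT
  -- the (constant) threshold function
  set r₁ : ℝ := min r₀ (Real.sqrt (max K 0 + 1))⁻¹
  have hsqrtK : 0 < Real.sqrt (max K 0 + 1) := Real.sqrt_pos.2 (by positivity)
  have hr₁ : 0 < r₁ := lt_min hr₀ (inv_pos.2 hsqrtK)
  refine ⟨fun _ ↦ r₁, fun _ _ ↦ hr₁, fun _ _ _ _ _ ↦ le_rfl, ?_⟩
  intro t ht x hR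
  have hR' : r₁⁻¹ ^ 2 ≤ (g t).scalarCurvatureWith (cov t) x := hR
  by_cases ht1 : 1 ≤ t
  · -- late times: Theorem 4.1 applies since `r₁ ≤ r₀`
    refine H41 M g cov T hmax.isRicciFlow hmax.isRiemannian hT le_rfl hPIC' hnc' hpinch' t ht ht1 x ?_
    calc r₀⁻¹ ^ 2 ≤ r₁⁻¹ ^ 2 := by
          gcongr
          exact min_le_left _ _
      _ ≤ (g t).scalarCurvatureWith (cov t) x := hR'
  · -- early times: `R ≤ K < r₁⁻²`, so the hypothesis is void
    exfalso
    have htI : t ∈ Icc (0 : ℝ) 1 := ⟨ht.1, (not_le.1 ht1).le⟩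
    have h1 : (g t).scalarCurvatureWith (cov t) x ≤ K := hK t htI x
    have h2 : Real.sqrt (max K 0 + 1) ≤ r₁⁻¹ := by
      rw [le_inv_comm₀ hsqrtK hr₁]
      exact min_le_right _ _
    have h3 : max K 0 + 1 ≤ r₁⁻¹ ^ 2 := by
      calc max K 0 + 1 = Real.sqrt (max K 0 + 1) ^ 2 := (Real.sq_sqrt (by positivity)).symm
        _ ≤ r₁⁻¹ ^ 2 := by gcongr
    have h4 : K ≤ max K 0 := le_max_left _ _
    linarith


/-! ### Appended 2026-08-15 (review of the decomposition): status of Theorem 4.1, and its Step 0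

`chenZhu_canonicalNeighbourhoodTheorem` has been reviewed a third time against the source
(arXiv:math/0504478: Thm. 4.1 and its proof, pp. 19–23; Thm. 3.8, pp. 17–18; Prop. 3.6, p. 16;
§5, p. 26). The statement is the printed one — every deviation strengthens a hypothesis (compact,
simply connected, frame-wise noncollapsing, a bound `T ≤ T₁` on the final time) or weakens the
conclusion (`C⁰` necks) — and it is correctly cut from `chenZhu_aprioriAssumptions_smoothSolution`
by the printed one-sentence proof of p. 26 (above). What remains below it is a THEORY: the printed
proof of Thm. 4.1 is Perelman's compactness-and-contradiction scheme (2002, Thm. 12.1) —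
(0) selection of an adjusted base point (p. 20); (1) a local curvature bound, integrating the
gradient estimates of Prop. 3.6 (ii) along geodesics (p. 20); (2) bounded rescaled curvature at
bounded distance, by Hamilton's compactness theorem on balls, the injectivity radius bound from
`κ`-noncollapsing, Thm. 3.8 applied in the limit, the Alexandrov completion with its
Burago–Gromov–Perelman tangent cones, and Hamilton's strong maximum principle with (2.4)
(pp. 21–22), after which Shi's local derivative estimates give a `C^∞_loc` limit (p. 22);
(3) bounded curvature of the limit slice, by the splitting Lemma 3.1 and Prop. 2.2 (p. 22);
(4) extension backwards to `-∞`, by the Li–Yau–Hamilton inequality and Perelman's distance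
distortion estimate, Lemma 8.3 (b) (pp. 22–23) — run over the whole of §3 (Lemma 3.2,
Props. 3.3–3.4, the universal noncollapsing Thm. 3.5 via the reduced volume, Prop. 3.6, Cor. 3.7,
Thm. 3.8), followed by the transfer of necks, caps, curvature and volume bounds from the ancient
`κ`-solution to the solution through `C^{[ε⁻¹]}`-closeness (p. 21; p. 26, "twice bigger than the
corresponding constants `C₁(ε/2)` and `C₂(ε/2)`"). None of these inputs — Cheeger–Gromov–Hamilton
compactness, local Shi estimates, the Harnack inequality, reduced length and volume, Alexandrov
tangent cones, ancient `κ`-solutions, `C^k`-closeness of metrics on regions — is in the tree yet,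
as theorem or as statement (the global Shi estimates of `ShiDerivativeMaxPrinciple.lean` are the
maximum-principle form, not the local one); so the fact stays a named fact, in the trust base of
`hamilton_chen_tang_zhu` next to `perelman_noLocalCollapsing`.

Step (0) is elementary and is PROVED here, in the generality in which p. 20 uses it (an
arbitrary set `P` of "bad" space-time points, an arbitrary function `R` bounded above on the
relevant time slab): **Perelman's point selection** — "we may adjust the point `(x_k, t_k)` with
`t_k ≥ ½` and with `Q_k = R_k(x_k, t_k)` as large as possible so that the conclusion of the
theorem fails at `(x_k, t_k)`, but holds for any `(x, t) ∈ M⁴_k × [t_k - H_k Q_k⁻¹, t_k]`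
satisfying `R(x, t) ≥ 2Q_k`" (Chen–Zhu 2006, p. 20). The printed proof runs a doubling chain
`R(x^{(ℓ)}) ≥ 2R(x^{(ℓ-1)})`, `t^{(ℓ)} ≥ t_k - 2H_k Q_k⁻¹ ≥ ½`, terminated by the boundedness of `R`
on `M × [0, t_k]`; the proof below takes instead an almost-maximiser of `R` over the set of all
admissible successors, which is the same argument without the induction.
-/

section PointSelection

variable {α : Type*}

/-- **Perelman's point selection, abstract form** (Chen–Zhu 2006, proof of Thm. 4.1, arXiv p. 20;
after Perelman 2002, proof of Thm. 12.1). Let `P ⊆ α × ℝ` be a set of "bad" space-time points,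
`R : α × ℝ → ℝ`, `p₁ ∈ P` with `R p₁ > 0`, `H > 0`, and suppose `R ≤ K` at the bad points with
times in the slab `[p₁.2 - 2H (R p₁)⁻¹, p₁.2]`. Then some bad point `p̄` of that slab has
`R p̄ ≥ R p₁` and the property that every bad point `q` with time in `[p̄.2 - H (R p̄)⁻¹, p̄.2]`
satisfies `R q < 2 R p̄`. Proof: the admissible points — `p ∈ P`, `R p ≥ R p₁`, `p.2 ≤ p₁.2`,
`p.2 ≥ p₁.2 - 2H (R p₁)⁻¹ + 2H (R p)⁻¹` (the printed bound `t^{(ℓ)} ≥ t_k - H_k Σᵢ (2^{i-1}Q_k)⁻¹`)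
— have `R`-values bounded by `K`; an admissible `p̄` with `R p̄ > ½ sup` works, since a bad `q`
in its slab with `R q ≥ 2R p̄` would again be admissible with `R q > sup`.
[cite: ChenZhu2006, proof of Thm. 4.1, p. 20] [cite: Perelman2002, §12, Thm. 12.1] -/
theorem exists_adjustedBasepoint (P : Set (α × ℝ)) (R : α × ℝ → ℝ) {p₁ : α × ℝ} (hp₁ : p₁ ∈ P)
    (hR₁ : 0 < R p₁) {H K : ℝ} (hH : 0 < H)
    (hK : ∀ p ∈ P, p₁.2 - 2 * H / R p₁ ≤ p.2 → p.2 ≤ p₁.2 → R p ≤ K) :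
    ∃ p ∈ P, R p₁ ≤ R p ∧ p₁.2 - 2 * H / R p₁ ≤ p.2 ∧ p.2 ≤ p₁.2 ∧
      ∀ q ∈ P, p.2 - H / R p ≤ q.2 → q.2 ≤ p.2 → R q < 2 * R p := by
  -- the admissible successors of `p₁`
  obtain ⟨A, hmem⟩ : ∃ A : Set (α × ℝ), ∀ p, p ∈ A ↔
      p ∈ P ∧ R p₁ ≤ R p ∧ p.2 ≤ p₁.2 ∧ p₁.2 - 2 * H / R p₁ + 2 * H / R p ≤ p.2 :=
    ⟨{p | p ∈ P ∧ R p₁ ≤ R p ∧ p.2 ≤ p₁.2 ∧ p₁.2 - 2 * H / R p₁ + 2 * H / R p ≤ p.2},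
      fun _ ↦ Iff.rfl⟩
  have hp₁A : p₁ ∈ A := (hmem p₁).2 ⟨hp₁, le_rfl, le_rfl, by linarith⟩
  -- every admissible point lies in the slab, so that `R ≤ K` on `A`
  have hslab : ∀ p ∈ A, p₁.2 - 2 * H / R p₁ ≤ p.2 := by
    intro p hp
    obtain ⟨-, hRp, -, hp4⟩ := (hmem p).1 hp
    have : 0 < 2 * H / R p := div_pos (by linarith) (hR₁.trans_le hRp)
    linarith
  have hbdd : BddAbove (R '' A) := by
    refine ⟨K, ?_⟩
    rintro _ ⟨p, hp, rfl⟩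
    obtain ⟨hpP, -, hpt, -⟩ := (hmem p).1 hp
    exact hK p hpP (hslab p hp) hpt
  have hne : (R '' A).Nonempty := ⟨R p₁, p₁, hp₁A, rfl⟩
  -- an almost-maximiser of `R` on `A`
  have hS₁ : R p₁ ≤ sSup (R '' A) := le_csSup hbdd ⟨p₁, hp₁A, rfl⟩
  have hSpos : 0 < sSup (R '' A) := hR₁.trans_le hS₁
  obtain ⟨_, ⟨p, hpA, rfl⟩, hpS⟩ := exists_lt_of_lt_csSup hne (half_lt_self hSpos)
  obtain ⟨hpP, hpR, hpt, hp4⟩ := (hmem p).1 hpA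
  refine ⟨p, hpP, hpR, hslab p hpA, hpt, fun q hq hq1 hq2 ↦ ?_⟩
  by_contra hlt
  push Not at hlt
  -- otherwise `q` is admissible too, whence `R q ≤ sup < 2 R p ≤ R q`
  have hRp : 0 < R p := hR₁.trans_le hpR
  have hRq : 0 < R q := by linarith
  have h1 : 2 * H / R q ≤ H / R p := by
    rw [div_le_div_iff₀ hRq hRp]
    have := mul_le_mul_of_nonneg_left hlt hH.le
    linarith
  have h2 : 2 * H / R p = 2 * (H / R p) := by ring
  have hqA : q ∈ A :=
    (hmem q).2 ⟨hq, hpR.trans (by linarith), hq2.trans hpt, by linarith [hp4, hq1, h1, h2]⟩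
  have hqS : R q ≤ sSup (R '' A) := le_csSup hbdd ⟨q, hqA, rfl⟩
  linarith

/-- **Perelman's point selection for a Ricci flow on a closed manifold** — the form used on p. 20
(there `H = ¼ r_k⁻²` and `Q_k ≥ r_k⁻² = 4H`, `t_k ≥ 1`, so that the adjusted time is `≥ ½`): for a
Ricci flow `(g, cov)` on `[0, T)` on a compact manifold without boundary, any set `P` of
space-time points, `(x₁, t₁) ∈ P` with `1 ≤ t₁ < T`, and `H > 0` with `R(x₁, t₁) ≥ 4H`, there is
`(x̄, t̄) ∈ P` with `t̄ ∈ [t₁ - ½, t₁]`, `R(x̄, t̄) ≥ R(x₁, t₁)`, such that every `(y, s) ∈ P` with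
`s ∈ [t̄ - H R(x̄, t̄)⁻¹, t̄]` has `R(y, s) < 2R(x̄, t̄)`; the boundedness of `R` on `M × [0, t₁]`
that terminates the printed doubling chain is `IsRicciFlow.exists_scalarCurvatureWith_le_of_lt`
(`RicciFlowRegularity.lean`). [cite: ChenZhu2006, proof of Thm. 4.1, p. 20] -/
theorem IsRicciFlow.exists_adjustedPoint
    {E : Type*} [NormedAddCommGroup E] [NormedSpace ℝ E] [FiniteDimensional ℝ E] [CompleteSpace E]
    {H' : Type*} [TopologicalSpace H'] {I : ModelWithCorners ℝ E H'} [I.Boundaryless]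
    {M : Type*} [TopologicalSpace M] [CompactSpace M] [ChartedSpace H' M] [IsManifold I ∞ M]
    {g : ℝ → PseudoRiemannianMetric I ∞ E (TangentSpace I : M → Type _)}
    {cov : ℝ → CovariantDerivative I E (TangentSpace I : M → Type _)} {T : ℝ}
    (hflow : IsRicciFlow g cov (Ico 0 T)) (P : Set (M × ℝ)) {x₁ : M} {t₁ H : ℝ}
    (hP : (x₁, t₁) ∈ P) (ht₁ : 1 ≤ t₁) (ht₁T : t₁ < T) (hH : 0 < H)
    (hQ : 4 * H ≤ (g t₁).scalarCurvatureWith (cov t₁) x₁) :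
    ∃ (x : M) (t : ℝ), (x, t) ∈ P ∧ t₁ - 1 / 2 ≤ t ∧ t ≤ t₁ ∧
      (g t₁).scalarCurvatureWith (cov t₁) x₁ ≤ (g t).scalarCurvatureWith (cov t) x ∧
      ∀ (y : M) (s : ℝ), (y, s) ∈ P → t - H / (g t).scalarCurvatureWith (cov t) x ≤ s → s ≤ t →
        (g s).scalarCurvatureWith (cov s) y < 2 * (g t).scalarCurvatureWith (cov t) x := by
  obtain ⟨K, hK⟩ := hflow.exists_scalarCurvatureWith_le_of_lt ht₁T
  let R : M × ℝ → ℝ := fun p ↦ (g p.2).scalarCurvatureWith (cov p.2) p.1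
  have hQ' : 4 * H ≤ R (x₁, t₁) := hQ
  have hR₁ : 0 < R (x₁, t₁) := by linarith
  have hwin : 2 * H / R (x₁, t₁) ≤ 1 / 2 := by
    rw [div_le_iff₀ hR₁]
    linarith
  have hK' : ∀ p ∈ P, (x₁, t₁).2 - 2 * H / R (x₁, t₁) ≤ p.2 → p.2 ≤ (x₁, t₁).2 → R p ≤ K := by
    intro p _ hlo hhi
    have hlo' : t₁ - 2 * H / R (x₁, t₁) ≤ p.2 := hlo
    have hhi' : p.2 ≤ t₁ := hhi
    exact hK p.2 ⟨by linarith, hhi'⟩ p.1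
  obtain ⟨p, hpP, hRp, hlow, hup, hgood⟩ := exists_adjustedBasepoint P R hP hR₁ hH hK'
  have hlow' : t₁ - 2 * H / R (x₁, t₁) ≤ p.2 := hlow
  have hup' : p.2 ≤ t₁ := hup
  refine ⟨p.1, p.2, hpP, by linarith, hup', hRp, fun y s hys hlo hhi ↦ ?_⟩
  exact hgood (y, s) hys hlo hhi

end PointSelection

end Literature.Geometry.Riemannian

end
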